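import Literature.NumberTheory.DiophantineGeometry.GarciaStichtenothPlaces
import Literature.NumberTheory.DiophantineGeometry.FunctionFieldGenusRatPlacesProofs
import Mathlib.FieldTheory.Finite.Basic
import HarnessLib

/-!
# The Garcia–Stichtenoth tower over `𝔽_{q²}`: complete splitting and the count of rational places
(Stichtenoth Lemma 7.4.4)

Topic: `Literature/NumberTheory/DiophantineGeometry` (sub-namespace `GSTower`). Over `K = 𝔽_{q²}` the
`q² - q` rational places `x₀ = γ`, `γ ∈ 𝔽_{q²} ∖ 𝔽_q`, of `K(x₀)` split completely in every level of
the tower [Stichtenoth 2009, Lemma 7.4.4]: if `x_N(Q) = γ ∉ 𝔽_q` then `T^q - T - u(γ)` has `q` distinct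
roots `β ∈ 𝔽_{q²} ∖ 𝔽_q` (`β^{q²} = β`, (7.17)–(7.18); here: `T^{q²} - T = (T^q - T - ω)^q + (T^q - T - ω)`
for `ω = u(γ)`, `ω^q = -ω`), so by Kummer's theorem (`FunctionFieldDedekindKummer`) there are `q`
rational places of `G_{N+1}` above `Q`, at which `x_{N+1} ≡ β ∉ 𝔽_q`. Hence
(`GSTower.exists_ratPlaces_level`) **`G_N` has at least `(q² - q) q^N + 1` rational places**
(the `+1` being `P_∞`).

## References

* H. Stichtenoth, *Algebraic Function Fields and Codes*, 2nd ed., GTM 254 (2009): Lemma 7.4.4,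
  Cor. 7.2.21, Prop. 3.7.10 (d). [Stichtenoth2009]
-/

noncomputable section

open scoped Classical Polynomial IntermediateField
open Polynomial

namespace Literature.NumberTheory.DiophantineGeometry

open AlgFunctionField

namespace GSTower

variable {K : Type} [Field K] [Fintype K] {q : ℕ} [hq : Fact (2 ≤ q)]
variable {p n : ℕ} [Fact p.Prime] [CharP K p]

/-! ### Lemma 7.4.4: the roots of `T^q - T - u(γ)` lie in `𝔽_{q²} ∖ 𝔽_q` -/

omit [Fintype K] in
/-- `(a - b)^q = a^q - b^q` in `K`, `q = pⁿ`. [folklore] -/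
theorem sub_pow_q (hqp : q = p ^ n) (a b : K) : (a - b) ^ q = a ^ q - b ^ q := by
  subst hqp; exact sub_pow_char_pow a b n

omit [Fintype K] in
/-- `(f - g)^q = f^q - g^q` in `K[X]`, `q = pⁿ`. [folklore] -/
theorem sub_pow_q_poly (hqp : q = p ^ n) (f g : K[X]) : (f - g) ^ q = f ^ q - g ^ q := by
  haveI : CharP K[X] p := inferInstance
  subst hqp; exact sub_pow_char_pow f g n

/-- **Lemma 7.4.4**: over `K = 𝔽_{q²}`, for `γ ∈ K ∖ 𝔽_q` the polynomial `T^q - T - u(γ)` has `q`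
distinct roots in `K`, none of them in `𝔽_q`. [cite: Stichtenoth2009, Lemma 7.4.4] -/
theorem exists_roots (hK : Fintype.card K = q ^ 2) (hqp : q = p ^ n) {γ : K} (hγ : γ ^ q ≠ γ) :
    ∃ c : Fin q → K, Function.Injective c ∧ ∀ j, (c j) ^ q - c j = u q γ ∧ (c j) ^ q ≠ c j := by
  have hq2 := hq.out
  have hqK : (q : K) = 0 := Level.cast_q_eq_zero (K := K) hqp
  have hγ0 : γ ≠ 0 := by rintro rfl; exact hγ (by rw [zero_pow (by omega)])
  have hG0 : γ ^ q ≠ 0 := pow_ne_zero _ hγ0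
  have hcardK : Fintype.card K = q * q := by rw [hK, sq]
  have hpowcard : ∀ a : K, a ^ (q * q) = a := fun a => by rw [← hcardK]; exact FiniteField.pow_card a
  have hden : 1 - γ ^ (q - 1) ≠ 0 := by
    intro h
    apply hγ
    have h1 : γ ^ (q - 1) = 1 := (sub_eq_zero.1 h).symm
    calc γ ^ q = γ ^ (q - 1) * γ := by rw [← pow_succ, Nat.sub_add_cancel (by omega)]
      _ = γ := by rw [h1, one_mul]
  set ω : K := u q γ with hω
  have hω0 : ω ≠ 0 := div_ne_zero hG0 hden
  -- `ω^q = -ω` ((7.17)–(7.18))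
  have hpow1 : γ ^ (q - 1) = γ ^ q * γ⁻¹ := by
    rw [eq_mul_inv_iff_mul_eq₀ hγ0, ← pow_succ, Nat.sub_add_cancel (by omega)]
  have hpow2 : (γ ^ (q - 1)) ^ q = γ * (γ ^ q)⁻¹ := by
    rw [eq_mul_inv_iff_mul_eq₀ hG0, ← pow_mul, ← pow_add, show (q - 1) * q + q = q * q by
      rw [Nat.sub_one_mul, Nat.sub_add_cancel (Nat.le_mul_self q)], hpowcard]
  have hωq : ω ^ q = -ω := by
    have hGγ : γ ^ q - γ ≠ 0 := sub_ne_zero.2 hγ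
    rw [hω, u, div_pow, ← pow_mul, hpowcard, sub_pow_q hqp, one_pow, hpow2, hpow1]
    field_simp
    ring
  -- `T^{q²} - T = P^q + P` with `P = T^q - T - ω`, so `P` splits in `K` with distinct roots
  set P : K[X] := X ^ q - X - C ω with hP
  have hPq : P ^ q + P = X ^ (q * q) - X := by
    rw [hP, sub_pow_q_poly hqp, sub_pow_q_poly hqp, ← pow_mul, ← C_pow, hωq, C_neg]; ring
  have hQ0 : (X ^ (q * q) - X : K[X]) ≠ 0 := by
    rw [← hcardK]; exact FiniteField.X_pow_card_sub_X_ne_zero K Fintype.one_lt_card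
  have hQsplit : Splits (X ^ (q * q) - X : K[X]) := by
    rw [splits_iff_card_roots, ← hcardK, FiniteField.roots_X_pow_card_sub_X,
      FiniteField.X_pow_card_sub_X_natDegree_eq K Fintype.one_lt_card]
    rfl
  have hPsplit : Splits P :=
    hQsplit.of_dvd hQ0 ⟨P ^ (q - 1) + 1, by
      rw [← hPq, mul_add, mul_one, ← pow_succ', Nat.sub_add_cancel (by omega)]⟩
  have hPsep : P.Separable := PlaceOver.separable_X_pow_sub_X_sub_C hqK ω
  have hPdeg : P.natDegree = q := natDegree_X_pow_sub_X_sub_C ω hq2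
  have hcard : P.roots.toFinset.card = q := by
    rw [Multiset.toFinset_card_of_nodup (nodup_roots hPsep), ← hPdeg, hPsplit.natDegree_eq_card_roots]
  set e := Finset.equivFinOfCardEq hcard with he
  refine ⟨fun j => (e.symm j : K), fun i j hij => e.symm.injective (Subtype.ext hij), fun j => ?_⟩
  have hP0 : P ≠ 0 := fun h0 => by rw [h0, natDegree_zero] at hPdeg; omega
  have hroot : ((e.symm j : K)) ^ q - (e.symm j : K) = ω := by
    set b : K := (e.symm j : K) with hb
    have hmem : b ∈ P.roots.toFinset := (e.symm j).2
    have : eval b P = 0 := by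
      rw [Multiset.mem_toFinset, mem_roots hP0] at hmem; exact hmem
    rw [hP, eval_sub, eval_sub, eval_pow, eval_X, eval_C, sub_eq_zero] at this
    exact this
  exact ⟨hroot, fun h => hω0 (by rw [← hroot, h, sub_self])⟩

/-! ### `u(x) ≡ u(γ)` at a place where `x ≡ γ ∉ 𝔽_q` -/

omit [Fintype K] [Fact p.Prime] [CharP K p] in
/-- If `x ≡ γ (mod Q)` with `γ ∈ K ∖ 𝔽_q` then `u(x) ∈ 𝒪_Q` and `u(x) ≡ u(γ) (mod Q)` (`1 - x^{q-1}`
is a unit). [cite: Stichtenoth2009, Lemma 7.4.4 (proof)] -/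
theorem valuation_u_sub_lt {F : Type} [Field F] [Algebra K F] [IsAlgFunctionField K F] (Q : PlaceOver K F)
    {x : F} {γ : K} (hγ : γ ^ q ≠ γ) (hx : 0 < Q.ord (x - algebraMap K F γ)) :
    u q x ∈ Q.toValuationSubring ∧ Q.valuation (u q x - algebraMap K F (u q γ)) < 1 := by
  have hq2 := hq.out
  have hγ0 : γ ≠ 0 := by rintro rfl; exact hγ (by rw [zero_pow (by omega)])
  have hxγ : x ≠ algebraMap K F γ := sub_ne_zero.1 (Q.ne_zero_of_ord_ne_zero hx.ne')
  have hden : (1 - X ^ (q - 1) : K[X]).eval γ ≠ 0 := by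
    rw [eval_sub, eval_one, eval_pow, eval_X]
    intro h
    apply hγ
    calc γ ^ q = γ ^ (q - 1) * γ := by rw [← pow_succ, Nat.sub_add_cancel (by omega)]
      _ = γ := by rw [(sub_eq_zero.1 h).symm, one_mul]
  have hnum : (X ^ q : K[X]).eval γ = γ ^ q := by rw [eval_pow, eval_X]
  set a := aeval x (X ^ q : K[X]) with ha
  set b := aeval x (1 - X ^ (q - 1) : K[X]) with hb
  have hax : a = x ^ q := by rw [ha, map_pow, aeval_X]
  have hbx : b = 1 - x ^ (q - 1) := by rw [hb, map_sub, map_one, map_pow, aeval_X]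
  have hπ := Q.valuation_uniformizer_lt_one
  have hball : ∀ {z : F}, z ∈ Q.ball 1 → Q.valuation z < 1 := fun {z} hz => by
    have := (Q.mem_ball_iff 1 z).1 hz; rw [zpow_one] at this; exact this.trans_lt hπ
  have ha' := hball (Q.aeval_sub_mem_ball hx hxγ (X ^ q : K[X]))
  have hb' := hball (Q.aeval_sub_mem_ball hx hxγ (1 - X ^ (q - 1) : K[X]))
  rw [hnum] at ha'
  have hb1 : Q.valuation b = 1 := Q.valuation_aeval_eq_one hx hxγ _ hden
  have hb0 : b ≠ 0 := by intro h; rw [h, Valuation.map_zero] at hb1; exact zero_ne_one hb1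
  set b₀ := algebraMap K F ((1 - X ^ (q - 1) : K[X]).eval γ) with hb₀
  have hb₀1 : Q.valuation b₀ = 1 := by
    rw [hb₀, Q.valuation_eq_zpow_ord ((_root_.map_ne_zero _).2 hden), PlaceOver.ord_algebraMap_holds Q hden,
      zpow_zero]
  have hb₀0 : b₀ ≠ 0 := (_root_.map_ne_zero _).2 hden
  have ha1 : Q.valuation a ≤ 1 := Q.valuation_aeval_le_one hx hxγ _
  have hmem : u q x ∈ Q.toValuationSubring := by
    rw [u, ← hax, ← hbx]
    exact Q.aeval_div_aeval_mem hx hxγ _ _ hden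
  refine ⟨hmem, ?_⟩
  have hdiff : u q x - algebraMap K F (u q γ) = (a * (b₀ - b) + b * (a - algebraMap K F (γ ^ q))) / (b * b₀) := by
    rw [u, u, ← hax, ← hbx, map_div₀, show algebraMap K F (1 - γ ^ (q - 1)) = b₀ by
      rw [hb₀, eval_sub, eval_one, eval_pow, eval_X], div_sub_div _ _ hb0 hb₀0]
    congr 1; ring
  rw [hdiff, map_div₀, Valuation.map_mul, hb1, hb₀1, one_mul, div_one]
  refine Valuation.map_add_lt _ ?_ ?_
  · rw [Valuation.map_mul]
    calc Q.valuation a * Q.valuation (b₀ - b) ≤ 1 * Q.valuation (b₀ - b) := mul_le_mul_left ha1 _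
      _ < 1 := by rw [one_mul, ← Valuation.map_neg, neg_sub]; exact hb'
  · rw [Valuation.map_mul, hb1, one_mul]; exact ha'

/-! ### The step and the count -/

/-- The splitting invariant at a level: a set of rational places at which `x_N ≡ γ ∈ K ∖ 𝔽_q`.
(Auxiliary statement; `S` = the places above `x₀ = γ`, `γ ∈ 𝔽_{q²} ∖ 𝔽_q`.) [cite: Stichtenoth2009, Lemma 7.4.4] -/
theorem exists_split_next (hK : Fintype.card K = q ^ 2) (hqp : q = p ^ n) (L : Level K q)
    (S : Finset (PlaceOver K L.carrier))
    (hS : ∀ Q ∈ S, Q.IsRational ∧ ∃ γ : K, γ ^ q ≠ γ ∧ 0 < Q.ord (L.x L.N - algebraMap K L.carrier γ)) :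
    ∃ S' : Finset (PlaceOver K L.Next),
      (∀ Q' ∈ S', Q'.IsRational ∧ ∃ γ : K, γ ^ q ≠ γ ∧
        0 < Q'.ord (L.next.x (L.N + 1) - algebraMap K L.Next γ)) ∧ S'.card = q * S.card := by
  have hq2 := hq.out
  have hqK : (q : K) = 0 := Level.cast_q_eq_zero (K := K) hqp
  haveI := L.isSeparable_next hqK
  -- above each `Q ∈ S`, `q` rational places with `x_{N+1} ≡ β ∉ 𝔽_q`
  have hΨ : ∀ Q ∈ S, ∃ Ψ : Fin q → PlaceOver K L.Next, Function.Injective Ψ ∧ ∀ j,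
      (Ψ j).restrict (K := K) (F := L.carrier) = Q ∧ (Ψ j).IsRational ∧
      ∃ γ : K, γ ^ q ≠ γ ∧ 0 < (Ψ j).ord (AdjoinRoot.root L.poly - algebraMap K L.Next γ) := by
    intro Q hQ
    obtain ⟨hQrat, γ, hγ, hx⟩ := hS Q hQ
    obtain ⟨c, hcinj, hc⟩ := exists_roots hK hqp hγ
    obtain ⟨hwmem, hwval⟩ := valuation_u_sub_lt Q hγ hx
    obtain ⟨Ψ, hΨinj, hΨ⟩ := PlaceOver.exists_placesOver_of_pow_sub_eq_of_roots Q hq2 hwmem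
      L.root_pow_sub_root L.adjoin_root_eq_top L.finrank_next c hcinj (fun j => by
        rw [← map_pow, ← map_sub, (hc j).1, ← Valuation.map_neg, neg_sub]; exact hwval)
    refine ⟨Ψ, hΨinj, fun j => ⟨(hΨ j).1, (hΨ j).2.1.trans hQrat, c j, (hc j).2, ?_⟩⟩
    have hne : AdjoinRoot.root L.poly - algebraMap K L.Next (c j) ≠ 0 := by
      intro h0
      have h1 := L.root_pow_sub_root
      rw [sub_eq_zero.1 h0, L.algebraMap_next, ← map_pow, ← map_sub, ← map_pow, ← map_sub] at h1
      have h2 : algebraMap K L.carrier ((c j) ^ q - c j) = u q (L.x L.N) := (algebraMap L.carrier L.Next).injective h1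
      have h3 := L.ord_Pinf_u
      rw [← h2] at h3
      by_cases hc0 : (c j) ^ q - c j = 0
      · rw [hc0, map_zero] at h3; simp [PlaceOver.ord] at h3
      · rw [PlaceOver.ord_algebraMap_holds _ hc0] at h3; norm_num at h3
    exact (PlaceOver.valuation_lt_one_iff_ord_pos _ hne).1 (hΨ j).2.2
  choose Ψ hΨinj hΨspec using hΨ
  set S' := (S.attach ×ˢ (Finset.univ : Finset (Fin q))).image (fun x => Ψ x.1.1 x.1.2 x.2) with hS'
  have hinj : Set.InjOn (fun x : {Q // Q ∈ S} × Fin q => Ψ x.1.1 x.1.2 x.2)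
      ↑(S.attach ×ˢ (Finset.univ : Finset (Fin q))) := by
    rintro ⟨⟨Q, hQ⟩, j⟩ - ⟨⟨Q', hQ'⟩, j'⟩ - heq
    have hQQ' : Q = Q' := by
      have h1 := (hΨspec Q hQ j).1; have h2 := (hΨspec Q' hQ' j').1
      simp only at heq
      rw [← h1, ← h2, heq]
    subst hQQ'
    simp only at heq
    have := hΨinj Q hQ heq
    subst this; rfl
  refine ⟨S', fun Q' hQ' => ?_, ?_⟩
  · obtain ⟨⟨⟨Q, hQ⟩, j⟩, -, rfl⟩ := Finset.mem_image.1 hQ'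
    rw [L.next_x_succ]
    exact ⟨(hΨspec Q hQ j).2.1, (hΨspec Q hQ j).2.2⟩
  · rw [hS', Finset.card_image_of_injOn hinj, Finset.card_product, Finset.card_attach, Finset.card_univ,
      Fintype.card_fin, mul_comm]

omit [Fact p.Prime] [CharP K p] in
/-- **The bottom level**: the `q² - q` (at least) rational places `x₀ = γ`, `γ ∈ K ∖ 𝔽_q`, of `K(x₀)`
(`K = 𝔽_{q²}`). [cite: Stichtenoth2009, Lemma 7.4.4 and Cor. 1.2.3] -/
theorem exists_split_base (hK : Fintype.card K = q ^ 2) :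
    ∃ S : Finset (PlaceOver K (base K q).carrier),
      (∀ Q ∈ S, Q.IsRational ∧ ∃ γ : K, γ ^ q ≠ γ ∧
        0 < Q.ord ((base K q).x (base K q).N - algebraMap K (base K q).carrier γ)) ∧
      (q ^ 2 - q) * q ^ 0 ≤ S.card := by
  rw [pow_zero, mul_one]
  have hq2 := hq.out
  set T : Finset K := Finset.univ.filter (fun γ : K => γ ^ q ≠ γ) with hT
  refine ⟨T.image placeXSubC, fun Q hQ => ?_, ?_⟩
  · obtain ⟨γ, hγ, rfl⟩ := Finset.mem_image.1 hQ
    refine ⟨isRational_placeXSubC γ, γ, (Finset.mem_filter.1 hγ).2, ?_⟩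
    have hmem := X_sub_C_mem_placeXSubC γ
    have hnot := inv_X_sub_C_notMem_placeXSubC γ
    have hz0 : (RatFunc.X - RatFunc.C γ : RatFunc K) ≠ 0 := by
      intro h0; apply hnot; rw [h0, inv_zero]; exact zero_mem _
    have h1 := (placeXSubC γ).ord_nonneg_of_mem hmem
    rw [(placeXSubC γ).mem_toValuationSubring_iff_ord_nonneg (inv_ne_zero hz0), (placeXSubC γ).ord_inv hz0,
      not_le] at hnot
    have key : 0 < (placeXSubC γ).ord (RatFunc.X - RatFunc.C γ : RatFunc K) := by omega
    rw [← RatFunc.algebraMap_eq_C] at key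
    exact key
  · rw [Finset.card_image_of_injective _ placeXSubC_injective]
    have hroots : (Finset.univ.filter (fun γ : K => γ ^ q = γ)).card ≤ q := by
      have hsub : Finset.univ.filter (fun γ : K => γ ^ q = γ) ⊆ ((X ^ q - X : K[X]).roots).toFinset := by
        intro γ hγ
        rw [Multiset.mem_toFinset, mem_roots (FiniteField.X_pow_card_sub_X_ne_zero K (by omega)), IsRoot.def,
          eval_sub, eval_pow, eval_X, (Finset.mem_filter.1 hγ).2, sub_self]
      refine (Finset.card_le_card hsub).trans ((Multiset.toFinset_card_le _).trans ?_)
      have := Polynomial.card_roots' (X ^ q - X : K[X])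
      rwa [FiniteField.X_pow_card_sub_X_natDegree_eq K (by omega)] at this
    have hsplit := Finset.card_filter_add_card_filter_not (s := (Finset.univ : Finset K))
      (fun γ : K => γ ^ q = γ)
    rw [Finset.card_univ, hK] at hsplit
    have : (Finset.univ.filter (fun γ : K => ¬γ ^ q = γ)) = T := by rw [hT]
    rw [this] at hsplit
    omega

/-- **Complete splitting along the tower** (Lemma 7.4.4): level `N` has at least `(q² - q) q^N`
rational places at which `x_N ≡ γ ∈ K ∖ 𝔽_q`. [cite: Stichtenoth2009, Lemma 7.4.4] -/
theorem exists_split_level (hK : Fintype.card K = q ^ 2) (hqp : q = p ^ n) (N : ℕ) :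
    ∃ S : Finset (PlaceOver K (level K q N).carrier),
      (∀ Q ∈ S, Q.IsRational ∧ ∃ γ : K, γ ^ q ≠ γ ∧
        0 < Q.ord ((level K q N).x (level K q N).N - algebraMap K (level K q N).carrier γ)) ∧
      (q ^ 2 - q) * q ^ N ≤ S.card := by
  induction N with
  | zero => exact exists_split_base (K := K) (q := q) hK
  | succ N ih =>
    obtain ⟨S, hS, hcard⟩ := ih
    obtain ⟨S', hS', hcard'⟩ := exists_split_next hK hqp (level K q N) S hS
    rw [level_succ]
    refine ⟨S', fun Q' hQ' => ?_, ?_⟩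
    · rw [Level.next_N]; exact hS' Q' hQ'
    · rw [hcard']
      calc (q ^ 2 - q) * q ^ (N + 1) = q * ((q ^ 2 - q) * q ^ N) := by ring
        _ ≤ q * S.card := Nat.mul_le_mul_left q hcard

/-- **`G_N` has at least `(q² - q) q^N + 1` rational places** (Lemma 7.4.4 with Lemma 7.4.3: the split
places and `P_∞`; [GS96, §3]: `N(T_m) ≥ (q² - q)q^{m-1}`). [cite: Stichtenoth2009, Lemma 7.4.4 and Lemma 7.4.3] -/
theorem exists_ratPlaces_level (hK : Fintype.card K = q ^ 2) (hqp : q = p ^ n) (N : ℕ) :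
    ∃ T : Finset (PlaceOver K (level K q N).carrier), (∀ Q ∈ T, Q.IsRational) ∧
      (q ^ 2 - q) * q ^ N + 1 ≤ T.card := by
  obtain ⟨S, hS, hcard⟩ := exists_split_level hK hqp N
  have hPinf : (level K q N).Pinf ∉ S := by
    intro h
    obtain ⟨-, γ, -, hord⟩ := hS _ h
    have hmem : (level K q N).x (level K q N).N - algebraMap K _ γ ∈ (level K q N).Pinf.toValuationSubring :=
      ((level K q N).Pinf.mem_toValuationSubring_iff_ord_nonneg
        ((level K q N).Pinf.ne_zero_of_ord_ne_zero hord.ne')).2 hord.le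
    have hx : (level K q N).x (level K q N).N ∈ (level K q N).Pinf.toValuationSubring := by
      have := add_mem hmem ((level K q N).Pinf.algebraMap_mem γ)
      rwa [sub_add_cancel] at this
    have h0 := (level K q N).Pinf.ord_nonneg_of_mem hx
    rw [(level K q N).ord_Pinf_x_N] at h0
    norm_num at h0
  refine ⟨insert (level K q N).Pinf S, fun Q hQ => ?_, ?_⟩
  · rcases Finset.mem_insert.1 hQ with rfl | hQ
    · exact (level K q N).isRational_Pinf
    · exact (hS Q hQ).1
  · rw [Finset.card_insert_of_notMem hPinf]; omega

end GSTower

end Literature.NumberTheory.DiophantineGeometry
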